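/-
# Lattice sampling of Suzuki's screw function under «finitely many zeros off the line»

(rh-split cell, seat rh-split-screw-bridge g11, 2026-08-27; kernel scratch for card
`cards/SPLIT-screw-bridge.md` §16.)  Nothing in this file is a claim about the truth of RH.
-/
import Summits.RiemannHypothesis.RiemannHypothesis.Theorems.Splittings.ScrewGradedFloorDictionary
import Summits.RiemannHypothesis.RiemannHypothesis.Theses.RuelleBand
import HarnessLib

/-! CARVE-NOTE (rh-split-screw-bridge g11): part A of a three-part carve of the kernel
`HOME/rh-split-screw-bridge/g11/ScrewLatticeFoz.lean` (sha16 eab9b912b5bab0ac, 797 l): §§1–2 =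
kernel ll. 55–260 byte-identical; parts B (§3) and C (§§4–5) re-open the same namespace, so every
FQN of the kernel is unchanged.  The module docstring below describes the whole (A ‖ B ‖ C). -/

/-!
# Lattice sampling of the screw function under a cofinite strip hypothesis

Let `Ψ = zetaScrew` be Suzuki's screw function of `ζ` and, for a non-trivial zero `ρ`, write
`κ = ρ - 1/2 = σ + iγ`.  The unconditional zero series (`Suzuki2023_thm11_series_holds`)

  `Ψ(t) = Σ_ρ m(ρ) · Re[(cosh(κ t) - 1)/κ²]`

is sampled along a lattice `t = k h` (`k ∈ ℕ`, any fixed step `h > 0`).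

**Main theorem** (`strip_of_cofiniteStrip_of_latticeFloor`).  Let `h > 0`, `η ≥ 0`, `B' ∈ ℝ`.
If only finitely many non-trivial zeros have `|Re ρ - 1/2| > B'` and `Ψ(k h) ≥ -K e^{η k h}`
for all `k ∈ ℕ`, then every non-trivial zero satisfies `|Re ρ - 1/2| ≤ max B' η`.

At `B' = η = 0` (`rh_of_foz_of_latticeFloor`): **finitely many zeros off the critical line**
(`Theses.RuelleBand.CofiniteCriticalLine`, Bombieri's «J finite») **and** `Ψ(k h) ≥ -K` for all
`k` imply `RiemannHypothesis`; with the tree's converse directions (`Suzuki2023` Thm 1.7,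
`ScrewGradedFloor.abs_zetaScrew_le_exp_of_strip`) this is the splitting
`CofiniteCriticalLine ∧ (∀ k, 0 ≤ Ψ(k h)) ↔ RiemannHypothesis` for every `h > 0`
(`foz_and_latticePos_iff_rh`).

**Mechanism.**  Under the finiteness hypothesis the off-line zeros beyond `B'` form a finite
set with a top layer `|σ| = B`; on the top layer
`m Re[(cosh κt - 1)/κ²] = (e^{Bt}/2) Re[c_ρ e^{iλ_ρ t}] + O(‖c_ρ‖)` with `c_ρ = m/κ²`,
`λ_ρ = sgn(σ) γ`, and `Re c_ρ < 0` because `|γ| > 14 > 1/2 > |σ|`.  The lattice floor forces the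
finite trigonometric sum `s_k = Σ_T Re(c_ρ u_ρ^k)`, `u_ρ = e^{iλ_ρ h}`, to satisfy
`liminf s_k ≥ 0`; the Bohr-mean lemma `false_of_trigSum_eventually_ge` (window means over
`k ∈ [N, 2N)`, twisted by `ū_{ρ₀}^k`) shows this is impossible when all `Re c_ρ ≤ 0` and one is
`< 0`.  No arithmetic input on the ordinates is used: aliasing `λ_ρ h ∈ 2πℤ` only adds
non-positive resonant terms.
-/

set_option linter.dupNamespace false

noncomputable section

open Complex Filter Topology Finset
open scoped ComplexConjugate

namespace Summit.RiemannHypothesis.RiemannHypothesis.Theorems.Splittings.ScrewLatticeFoz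

open Literature.NumberTheory.LFunctions
open ZetaZeros.riemannZetaNontrivialZeros

/-! ## 1. Window sums of unimodular geometric sequences -/

/-- `‖Σ_{k ∈ [N,2N)} z^k‖ ≤ 2/‖1 - z‖` for `‖z‖ = 1`, `z ≠ 1`. -/
theorem norm_window_geom_sum_le {z : ℂ} (hz : ‖z‖ = 1) (hz1 : z ≠ 1) (N : ℕ) :
    ‖∑ k ∈ Finset.Ico N (2 * N), z ^ k‖ ≤ 2 / ‖1 - z‖ := by
  have hN : N ≤ 2 * N := by omega
  rw [geom_sum_Ico' hz1 hN, norm_div]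
  have h1 : ‖z ^ N - z ^ (2 * N)‖ ≤ 2 := by
    calc ‖z ^ N - z ^ (2 * N)‖ ≤ ‖z ^ N‖ + ‖z ^ (2 * N)‖ := norm_sub_le _ _
      _ = 2 := by rw [norm_pow, norm_pow, hz, one_pow, one_pow]; norm_num
  have h2 : 0 < ‖1 - z‖ := norm_pos_iff.2 (sub_ne_zero.2 (Ne.symm hz1))
  exact div_le_div_of_nonneg_right h1 h2.le

/-- At `z = 1` the window sum is `N`. -/
theorem window_geom_sum_one (N : ℕ) : ∑ k ∈ Finset.Ico N (2 * N), (1 : ℂ) ^ k = N := by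
  have h : 2 * N - N = N := by omega
  simp [h]

/-- `Re(w/2) = Re(w)/2`. -/
theorem re_div_two (w : ℂ) : (w / 2).re = w.re / 2 := by
  have h : w / 2 = w * ((1 / 2 : ℝ) : ℂ) := by push_cast; ring
  rw [h, Complex.re_mul_ofReal]; ring

/-- Window-mean bound: for `‖z‖ = 1` and `N ≥ 1`,
`Re(c · (1/N) Σ_{k∈[N,2N)} z^k) ≤ [z = 1]·Re c + [z ≠ 1]·‖c‖(2/‖1-z‖)/N`. -/
theorem re_mul_window_le (c : ℂ) {z : ℂ} (hz : ‖z‖ = 1) {N : ℕ} (hN : 1 ≤ N) :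
    (c * ((∑ k ∈ Finset.Ico N (2 * N), z ^ k) / N)).re ≤
      (if z = 1 then c.re else 0) + (if z = 1 then 0 else ‖c‖ * (2 / ‖1 - z‖)) / N := by
  have hN' : (0 : ℝ) < N := by exact_mod_cast hN
  by_cases h1 : z = 1
  · subst h1
    have hN'' : (N : ℂ) ≠ 0 := by exact_mod_cast hN'.ne'
    have h : (∑ k ∈ Finset.Ico N (2 * N), (1 : ℂ) ^ k) / (N : ℂ) = 1 := by
      rw [window_geom_sum_one, div_self hN'']
    rw [h, mul_one]
    simp
  · rw [if_neg h1, if_neg h1, zero_add]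
    calc (c * ((∑ k ∈ Finset.Ico N (2 * N), z ^ k) / N)).re
        ≤ ‖c * ((∑ k ∈ Finset.Ico N (2 * N), z ^ k) / N)‖ := Complex.re_le_norm _
      _ = ‖c‖ * (‖∑ k ∈ Finset.Ico N (2 * N), z ^ k‖ / N) := by
          rw [norm_mul, norm_div, Complex.norm_natCast]
      _ ≤ ‖c‖ * ((2 / ‖1 - z‖) / N) := by
          gcongr
          exact norm_window_geom_sum_le hz h1 N
      _ = ‖c‖ * (2 / ‖1 - z‖) / N := by ring

/-! ## 2. The Bohr-mean lemma for finite unimodular trigonometric sums -/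

/-- **Bohr-mean lemma.**  Let `T` be finite, `‖u_i‖ = 1`, `Re c_i ≤ 0` for all `i ∈ T` and
`Re c_{i₀} < 0` for some `i₀ ∈ T`.  Then the real sequence `s_k = Σ_{i∈T} Re(c_i u_i^k)` cannot
satisfy `liminf s_k ≥ 0`: for every such family there is `ε > 0` with `s_k < -ε` for infinitely
many `k`.  (Proof: the window mean of `s_k ū_{i₀}^k` over `k ∈ [N,2N)` has real part
`≤ Re c_{i₀}/2 + D/N` — resonant terms contribute `Re c_i ≤ 0`, the others `O(1/N)` — while
`liminf s_k ≥ 0` and `mean(s_k) ≤ D₀/N` force `mean |s_k| → 0`.) -/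
theorem false_of_trigSum_eventually_ge {ι : Type*} (T : Finset ι) (c u : ι → ℂ)
    (hu : ∀ i ∈ T, ‖u i‖ = 1) (hc : ∀ i ∈ T, (c i).re ≤ 0) {i₀ : ι} (hi₀ : i₀ ∈ T)
    (h0 : (c i₀).re < 0)
    (hS : ∀ ε : ℝ, 0 < ε → ∃ N₁ : ℕ, ∀ k : ℕ, N₁ ≤ k → -ε ≤ ∑ i ∈ T, (c i * u i ^ k).re) :
    False := by
  classical
  -- phases relative to `u i₀`
  set p : ι → ℂ := fun i ↦ u i * conj (u i₀) with hp
  set q : ι → ℂ := fun i ↦ conj (u i) * conj (u i₀) with hq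
  have hu₀ : ‖u i₀‖ = 1 := hu i₀ hi₀
  have hnp : ∀ i ∈ T, ‖p i‖ = 1 := fun i hi ↦ by
    simp only [hp, norm_mul, Complex.norm_conj, hu i hi, hu₀, mul_one]
  have hnq : ∀ i ∈ T, ‖q i‖ = 1 := fun i hi ↦ by
    simp only [hq, norm_mul, Complex.norm_conj, hu i hi, hu₀, mul_one]
  have hp₀ : p i₀ = 1 := by
    simp only [hp]
    rw [Complex.mul_conj, Complex.normSq_eq_norm_sq, hu₀]
    norm_num
  -- the error weights (independent of `N`)
  set w : ι → ℝ := fun i ↦ (if p i = 1 then 0 else ‖c i‖ * (2 / ‖1 - p i‖)) +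
      (if q i = 1 then 0 else ‖c i‖ * (2 / ‖1 - q i‖)) with hw
  set w₀ : ι → ℝ := fun i ↦ (if u i = 1 then 0 else ‖c i‖ * (2 / ‖1 - u i‖)) with hw₀
  have hw_nn : ∀ i, 0 ≤ w i := fun i ↦ by
    simp only [hw]; split_ifs <;> positivity
  have hw₀_nn : ∀ i, 0 ≤ w₀ i := fun i ↦ by
    simp only [hw₀]; split_ifs <;> positivity
  set D : ℝ := (∑ i ∈ T, w i) / 2 with hD
  set D₀ : ℝ := ∑ i ∈ T, w₀ i with hD₀
  have hD_nn : 0 ≤ D := by rw [hD]; exact div_nonneg (Finset.sum_nonneg fun i _ ↦ hw_nn i) two_pos.le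
  have hD₀_nn : 0 ≤ D₀ := Finset.sum_nonneg fun i _ ↦ hw₀_nn i
  -- ε and the window `[N, 2N)`
  set ε : ℝ := -(c i₀).re / 8 with hε
  have hε0 : 0 < ε := by rw [hε]; linarith
  obtain ⟨N₁, hN₁⟩ := hS ε hε0
  obtain ⟨N, hN, hN'⟩ : ∃ N : ℕ, max N₁ 1 ≤ N ∧ (D + D₀) / ε ≤ N := by
    obtain ⟨n, hn⟩ := exists_nat_ge ((D + D₀) / ε)
    refine ⟨max (max N₁ 1) n, le_max_left _ _, hn.trans ?_⟩
    exact_mod_cast le_max_right _ _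
  have hN1 : 1 ≤ N := le_trans (le_max_right _ _) hN
  have hNN₁ : N₁ ≤ N := le_trans (le_max_left _ _) hN
  have hNpos : (0 : ℝ) < N := by exact_mod_cast hN1
  have hDN : (D + D₀) / N ≤ ε := by
    rw [div_le_iff₀ hNpos]
    have h := hN'
    rw [div_le_iff₀ hε0] at h
    linarith
  -- the sequence and its twisted window mean
  set S : ℕ → ℝ := fun k ↦ ∑ i ∈ T, (c i * u i ^ k).re with hSdef
  set A : ℂ := (∑ k ∈ Finset.Ico N (2 * N), (S k : ℂ) * conj (u i₀) ^ k) / N with hA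
  -- (1) `‖A‖ ≤ mean |S|`
  have h1 : ‖A‖ ≤ (∑ k ∈ Finset.Ico N (2 * N), |S k|) / N := by
    rw [hA, norm_div, Complex.norm_natCast]
    gcongr
    refine (norm_sum_le _ _).trans (le_of_eq (Finset.sum_congr rfl fun k _ ↦ ?_))
    rw [norm_mul, norm_pow, Complex.norm_conj, hu₀, one_pow, mul_one, Complex.norm_real,
      Real.norm_eq_abs]
  -- (2) `A` as a sum of window means of geometric sequences
  have h2 : A = ∑ i ∈ T, (c i * ((∑ k ∈ Finset.Ico N (2 * N), p i ^ k) / N) +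
      conj (c i) * ((∑ k ∈ Finset.Ico N (2 * N), q i ^ k) / N)) / 2 := by
    have hSk : ∀ k : ℕ, (S k : ℂ) * conj (u i₀) ^ k =
        ∑ i ∈ T, (c i * p i ^ k + conj (c i) * q i ^ k) / 2 := by
      intro k
      simp only [hSdef]
      push_cast
      rw [Finset.sum_mul]
      refine Finset.sum_congr rfl fun i _ ↦ ?_
      rw [Complex.re_eq_add_conj, map_mul, map_pow]
      simp only [hp, hq, mul_pow]
      ring
    rw [hA, Finset.sum_congr rfl (fun k _ ↦ hSk k), Finset.sum_comm, Finset.sum_div]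
    refine Finset.sum_congr rfl fun i _ ↦ ?_
    rw [← Finset.sum_div, Finset.sum_add_distrib, ← Finset.mul_sum, ← Finset.mul_sum]
    ring
  -- (3) `Re A ≤ Re c_{i₀}/2 + D/N`
  have h3 : A.re ≤ (c i₀).re / 2 + D / N := by
    rw [h2, Complex.re_sum]
    have hterm : ∀ i ∈ T, ((c i * ((∑ k ∈ Finset.Ico N (2 * N), p i ^ k) / N) +
        conj (c i) * ((∑ k ∈ Finset.Ico N (2 * N), q i ^ k) / N)) / 2).re ≤
        (((if p i = 1 then (c i).re else 0) +
            (if p i = 1 then 0 else ‖c i‖ * (2 / ‖1 - p i‖)) / N) +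
          ((if q i = 1 then (c i).re else 0) +
            (if q i = 1 then 0 else ‖c i‖ * (2 / ‖1 - q i‖)) / N)) / 2 := by
      intro i hi
      have ha := re_mul_window_le (c i) (hnp i hi) hN1
      have hb := re_mul_window_le (conj (c i)) (hnq i hi) hN1
      rw [Complex.conj_re, Complex.norm_conj] at hb
      rw [re_div_two, Complex.add_re]
      linarith
    have hres : ∀ i ∈ T, (if p i = 1 then (c i).re else 0) + (if q i = 1 then (c i).re else 0) ≤
        (if i = i₀ then (c i₀).re else 0) := by
      intro i hi
      have hci := hc i hi
      by_cases hii : i = i₀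
      · subst hii
        rw [if_pos hp₀, if_pos rfl]
        split_ifs <;> linarith
      · rw [if_neg hii]
        split_ifs <;> linarith
    calc ∑ i ∈ T, ((c i * ((∑ k ∈ Finset.Ico N (2 * N), p i ^ k) / N) +
          conj (c i) * ((∑ k ∈ Finset.Ico N (2 * N), q i ^ k) / N)) / 2).re
        ≤ ∑ i ∈ T, ((if i = i₀ then (c i₀).re else 0) / 2 + w i / N / 2) := by
          refine Finset.sum_le_sum fun i hi ↦ (hterm i hi).trans ?_
          have h := hres i hi
          have hwN : w i / N = (if p i = 1 then 0 else ‖c i‖ * (2 / ‖1 - p i‖)) / N +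
              (if q i = 1 then 0 else ‖c i‖ * (2 / ‖1 - q i‖)) / N := by
            simp only [hw]
            rw [add_div]
          linarith
      _ = (c i₀).re / 2 + D / N := by
          rw [Finset.sum_add_distrib, ← Finset.sum_div, Finset.sum_ite_eq' T i₀, if_pos hi₀, hD]
          rw [← Finset.sum_div, ← Finset.sum_div]
          ring
  -- (4) `mean S ≤ D₀/N`
  have h4 : (∑ k ∈ Finset.Ico N (2 * N), S k) / N ≤ D₀ / N := by
    have hre : (∑ k ∈ Finset.Ico N (2 * N), S k) / N =
        ∑ i ∈ T, (c i * ((∑ k ∈ Finset.Ico N (2 * N), u i ^ k) / N)).re := by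
      simp only [hSdef]
      rw [Finset.sum_comm, Finset.sum_div]
      refine Finset.sum_congr rfl fun i _ ↦ ?_
      rw [← Complex.re_sum, ← Finset.mul_sum, ← Complex.div_natCast_re, mul_div_assoc]
    rw [hre, hD₀, Finset.sum_div]
    refine Finset.sum_le_sum fun i hi ↦ (re_mul_window_le (c i) (hu i hi) hN1).trans ?_
    have hci := hc i hi
    simp only [hw₀]
    split_ifs <;> linarith
  -- (5) `Σ |S k| ≤ Σ S k + 2 ε N` on the window (`S k ≥ -ε` there)
  have h5 : ∑ k ∈ Finset.Ico N (2 * N), |S k| ≤ ∑ k ∈ Finset.Ico N (2 * N), S k + 2 * ε * N := by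
    have h : ∑ k ∈ Finset.Ico N (2 * N), |S k| ≤ ∑ k ∈ Finset.Ico N (2 * N), (S k + 2 * ε) := by
      refine Finset.sum_le_sum fun k hk ↦ ?_
      have hk' : N₁ ≤ k := hNN₁.trans (Finset.mem_Ico.1 hk).1
      have hSk := hN₁ k hk'
      rcases le_or_gt 0 (S k) with h | h
      · rw [abs_of_nonneg h]; linarith
      · rw [abs_of_neg h]; linarith
    rw [Finset.sum_add_distrib, Finset.sum_const, Nat.card_Ico, nsmul_eq_mul] at h
    have hc' : ((2 * N - N : ℕ) : ℝ) = N := by rw [show 2 * N - N = N by omega]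
    rw [hc'] at h
    linarith
  -- (6) combine
  have h6 : -A.re ≤ ‖A‖ := (neg_le_abs _).trans (Complex.abs_re_le_norm A)
  have h7 : (∑ k ∈ Finset.Ico N (2 * N), |S k|) / N ≤ D₀ / N + 2 * ε := by
    calc (∑ k ∈ Finset.Ico N (2 * N), |S k|) / N
        ≤ (∑ k ∈ Finset.Ico N (2 * N), S k + 2 * ε * N) / N :=
          div_le_div_of_nonneg_right h5 hNpos.le
      _ = (∑ k ∈ Finset.Ico N (2 * N), S k) / N + 2 * ε := by
          field_simp
      _ ≤ D₀ / N + 2 * ε := by linarith [h4]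
  have h8 : D / N + D₀ / N = (D + D₀) / N := (add_div _ _ _).symm
  have h9 : -(c i₀).re / 2 - D / N ≤ D₀ / N + 2 * ε := by linarith [h3, h6, h1, h7]
  have h10 : -(c i₀).re / 2 = 4 * ε := by rw [hε]; ring
  linarith [hDN, hε0, h8, h9, h10]


end Summit.RiemannHypothesis.RiemannHypothesis.Theorems.Splittings.ScrewLatticeFoz
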